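import Summits.AnomalousDissipation.AnomalousDissipation.Theses.KolmogorovPincer
import Summits.AnomalousDissipation.AnomalousDissipation.Theorems.CellRoutesTaylorGreenForceRegularTG
import Summits.AnomalousDissipation.AnomalousDissipation.Theorems.KolmogorovPincerIncrementPincerTG
import Literature.Analysis.FluidPDE.DoeringFoiasProofs
import Literature.Analysis.FluidPDE.LerayHopfSpectralMeasurability
import Literature.Analysis.FluidPDE.AlexakisDoeringInterpolation
import Literature.Analysis.FluidPDE.LongTimeAverageNonneg
import Literature.Analysis.FluidPDE.LongTimeAverageSubadditive
import Literature.Analysis.FunctionSpaces.BesovDifference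
import Literature.Analysis.FunctionSpaces.FlatTorus

/-!
# Support item `KolmogorovPincer.OnsagerPincerTG` (stmt-AnomalousDissipation-32782), proved

Route `KolmogorovPincer` (decomp-ad cell, child of `RootDecompCycle1` on the blocker `RestMeanFloorTG`):
the LINEAR ONSAGER PINCER, the theorem-grade glue of the Onsager line (support, rank 9; never
load-bearing for `closes`).  On the ε-isoline `p(1+σ) = 4` of the Nikol'skii–Besov chart the floor point
`(3/4, 16/7)` is tied to the `H¹` corner `(1, 2)` and the ONSAGER corner `(1/3, 3)` by same-function
`L^p` interpolation (`7/16 = (5/8)·½ + (3/8)·⅓`):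
`[v]_{B^{3/4}_{16/7,∞}} ≤ [v]_{B^1_{2,∞}}^{5/8} · [v]_{B^{1/3}_{3,∞}}^{3/8}` and `[v]_{B^1_{2,∞}} ≤ √3 ‖∇v‖₂`
(DiPerna–Lions 1989, Lemma II.1, torus form; tree
`KolmogorovPincerIncrementPincerTG.eBesovSupSeminorm_one_two_le_sqrt_three`, cited by name), i.e. in
K41 weights `X⁸ ≤ (3D)⁵ Z³` pointwise in time with `X := ν^{5/8}[u]²_{B^{3/4}_{16/7,∞}}`,
`Z := [u]²_{B^{1/3}_{3,∞}}`, `D := ν‖∇u‖²`.  Young's inequality with a free parameter `l ≥ 1`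
linearises it (`X ≤ (15/8)·l·D + (3/8)·Z/l`), so NO Cauchy–Schwarz in time and NO measurability of the
`X`-signal are needed: the from-rest a-priori bound on the dissipation means (tree
`Torus.IsLerayHopfOn.intervalIntegral_power_bounds`, `E₀ = 0`) and `limsup = sInf` of eventual upper
bounds give: if the `X`-signal has limsup-mean `≥ ε > 0` and the Onsager signal satisfies the membership
clauses (a),(b) and has running means eventually `≤ M`, then
`4ε/(15·max(1, 3M/(4ε))) ≤ meanDissipation ν u` — for EVERY `ν > 0` and every global Leray–Hopf solution
from rest at the Taylor–Green force (no uniformity in ν).  The closed item `TaylorGreenForceRegularTG`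
(stmt-24257) enters BY NAME through the landed
`Theorems.TaylorGreenForceRegular.kolmogorovPincer_taylorGreenForceRegularTG`.
Ported verbatim (by name against the route file) from the decomp-ad lens-1 g14/g15 node files
(`CeilingLadder.lean` / `KolmogorovLagCut.lean`, `onsagerPincerTG_holds`, kernel-checked there
2026-08-30); landed by the cell's prover seat.  Nothing here proves the summit or either jaw.
References: Frisch 1995 §8.5.5; Doering–Foias 2002 §2; Triebel 1983 §2.5.12 (Nikol'skii spaces);
DiPerna–Lions 1989 Lemma II.1. [folklore estimates]
-/

set_option linter.dupNamespace false

noncomputable section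

namespace Summit.AnomalousDissipation.AnomalousDissipation.Theorems.KolmogorovPincerOnsagerPincerTG

open scoped BigOperators Topology Classical MeasureTheory InnerProductSpace
open Filter Set Function TopologicalSpace MeasureTheory
open scoped ENNReal
open Literature.Turb
open Literature.Analysis.FunctionSpaces
open Summit.AnomalousDissipation.AnomalousDissipation.Theses

section LpInterp

variable {α : Type*} [MeasurableSpace α] {μ : Measure α} {E : Type*} [NormedAddCommGroup E]

/-- Exponent bookkeeping for the `L²`–`L³` interpolation: `x^{16/7} = (x²)^{5/7} · (x³)^{2/7}`. -/
private lemma rpow_split_167_23 (x : ℝ≥0∞) :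
    x ^ (16 / 7 : ℝ) = (x ^ (2 : ℝ)) ^ (5 / 7 : ℝ) * (x ^ (3 : ℝ)) ^ (2 / 7 : ℝ) := by
  rw [← ENNReal.rpow_mul, ← ENNReal.rpow_mul,
    ← ENNReal.rpow_add_of_nonneg _ _ (by norm_num) (by norm_num)]
  norm_num

/-- Hölder form: `∫ |g|^{16/7} ≤ (∫ |g|²)^{5/7} (∫ |g|³)^{2/7}`. [folklore] -/
theorem lintegral_rpow_sixteen_sevenths_le_two_three {g : α → E} (hg : AEStronglyMeasurable g μ) :
    ∫⁻ a, ‖g a‖ₑ ^ (16 / 7 : ℝ) ∂μ ≤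
      (∫⁻ a, ‖g a‖ₑ ^ (2 : ℝ) ∂μ) ^ (5 / 7 : ℝ) * (∫⁻ a, ‖g a‖ₑ ^ (3 : ℝ) ∂μ) ^ (2 / 7 : ℝ) := by
  have h := ENNReal.lintegral_mul_norm_pow_le (μ := μ) (f := fun a => ‖g a‖ₑ ^ (2 : ℝ))
    (g := fun a => ‖g a‖ₑ ^ (3 : ℝ)) (hg.enorm.pow_const _) (hg.enorm.pow_const _)
    (p := 5 / 7) (q := 2 / 7) (by norm_num) (by norm_num) (by norm_num)
  simp_rw [rpow_split_167_23]
  exact h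


/-- **Same-function interpolation** `‖g‖_{16/7} ≤ ‖g‖₂^{5/8} ‖g‖₃^{3/8}`
(`7/16 = (5/8)·½ + (3/8)·⅓`). [folklore] -/
theorem eLpNorm_sixteen_sevenths_le_two_three {g : α → E} (hg : AEStronglyMeasurable g μ) :
    eLpNorm g (16 / 7 : ℝ≥0∞) μ ≤
      eLpNorm g 2 μ ^ (5 / 8 : ℝ) * eLpNorm g 3 μ ^ (3 / 8 : ℝ) := by
  have h167_0 : (16 / 7 : ℝ≥0∞) ≠ 0 := by simp
  have h167_t : (16 / 7 : ℝ≥0∞) ≠ ⊤ := by simp [ENNReal.div_eq_top]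
  have t167 : (16 / 7 : ℝ≥0∞).toReal = 16 / 7 := by rw [ENNReal.toReal_div]; norm_num
  have h3_0 : (3 : ℝ≥0∞) ≠ 0 := by norm_num
  have h3_t : (3 : ℝ≥0∞) ≠ ⊤ := ENNReal.ofNat_ne_top
  rw [eLpNorm_eq_lintegral_rpow_enorm_toReal h167_0 h167_t,
    eLpNorm_eq_lintegral_rpow_enorm_toReal two_ne_zero ENNReal.ofNat_ne_top,
    eLpNorm_eq_lintegral_rpow_enorm_toReal h3_0 h3_t, t167, ENNReal.toReal_ofNat, ENNReal.toReal_ofNat]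
  have h := lintegral_rpow_sixteen_sevenths_le_two_three (μ := μ) hg
  calc (∫⁻ a, ‖g a‖ₑ ^ (16 / 7 : ℝ) ∂μ) ^ (1 / (16 / 7 : ℝ))
      ≤ ((∫⁻ a, ‖g a‖ₑ ^ (2 : ℝ) ∂μ) ^ (5 / 7 : ℝ) *
          (∫⁻ a, ‖g a‖ₑ ^ (3 : ℝ) ∂μ) ^ (2 / 7 : ℝ)) ^ (1 / (16 / 7 : ℝ)) :=
        ENNReal.rpow_le_rpow h (by norm_num)
    _ = ((∫⁻ a, ‖g a‖ₑ ^ (2 : ℝ) ∂μ) ^ (1 / (2 : ℝ))) ^ (5 / 8 : ℝ) *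
          ((∫⁻ a, ‖g a‖ₑ ^ (3 : ℝ) ∂μ) ^ (1 / (3 : ℝ))) ^ (3 / 8 : ℝ) := by
        rw [ENNReal.mul_rpow_of_nonneg _ _ (by norm_num), ← ENNReal.rpow_mul, ← ENNReal.rpow_mul,
          ← ENNReal.rpow_mul, ← ENNReal.rpow_mul]
        norm_num


end LpInterp

section Torus

/-- **Floor jaw under the Onsager corner**:
`[v]_{B^{3/4}_{16/7,∞}} ≤ [v]_{B^1_{2,∞}}^{5/8} · [v]_{B^{1/3}_{3,∞}}^{3/8}`. [folklore] -/
theorem eBesovSupSeminorm_floor_le_onsager {v : UnitAddTorus (Fin 3) → EuclideanSpace ℝ (Fin 3)}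
    (hv : AEStronglyMeasurable v volume) :
    eBesovSupSeminorm (3 / 4 : ℝ) (16 / 7 : ℝ≥0∞) v volume ≤
      eBesovSupSeminorm 1 2 v volume ^ (5 / 8 : ℝ) *
        eBesovSupSeminorm (1 / 3 : ℝ) (3 : ℝ≥0∞) v volume ^ (3 / 8 : ℝ) := by
  set N₁ := eBesovSupSeminorm 1 2 v volume with hN₁
  set NO := eBesovSupSeminorm (1 / 3 : ℝ) (3 : ℝ≥0∞) v volume with hNO
  rw [eBesovSupSeminorm_def]
  refine iSup₂_le fun h hh => ?_
  have hpos : 0 < ‖h‖ := norm_pos_iff.2 hh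
  rw [ENNReal.div_le_iff (ofReal_norm_rpow_pos _ hh).ne' ENNReal.ofReal_ne_top]
  have hg : AEStronglyMeasurable (fun x => v (x + h) - v x) volume :=
    (aestronglyMeasurable_comp_add_right hv h).sub hv
  have h2 : eLpNorm (fun x => v (x + h) - v x) 2 volume ≤ N₁ * ENNReal.ofReal (‖h‖ ^ (1 : ℝ)) :=
    eLpNorm_sub_le_eBesovSupSeminorm_mul hh
  have h3 : eLpNorm (fun x => v (x + h) - v x) (3 : ℝ≥0∞) volume ≤
      NO * ENNReal.ofReal (‖h‖ ^ (1 / 3 : ℝ)) :=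
    eLpNorm_sub_le_eBesovSupSeminorm_mul hh
  calc eLpNorm (fun x => v (x + h) - v x) (16 / 7 : ℝ≥0∞) volume
      ≤ eLpNorm (fun x => v (x + h) - v x) 2 volume ^ (5 / 8 : ℝ) *
          eLpNorm (fun x => v (x + h) - v x) (3 : ℝ≥0∞) volume ^ (3 / 8 : ℝ) :=
        eLpNorm_sixteen_sevenths_le_two_three hg
    _ ≤ (N₁ * ENNReal.ofReal (‖h‖ ^ (1 : ℝ))) ^ (5 / 8 : ℝ) *
          (NO * ENNReal.ofReal (‖h‖ ^ (1 / 3 : ℝ))) ^ (3 / 8 : ℝ) := by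
        gcongr
    _ = N₁ ^ (5 / 8 : ℝ) * NO ^ (3 / 8 : ℝ) * ENNReal.ofReal (‖h‖ ^ (3 / 4 : ℝ)) := by
        rw [ENNReal.mul_rpow_of_nonneg _ _ (by norm_num), ENNReal.mul_rpow_of_nonneg _ _ (by norm_num),
          ENNReal.ofReal_rpow_of_nonneg (by positivity) (by norm_num),
          ENNReal.ofReal_rpow_of_nonneg (by positivity) (by norm_num),
          ← Real.rpow_mul hpos.le, ← Real.rpow_mul hpos.le, mul_mul_mul_comm,
          ← ENNReal.ofReal_mul (by positivity), ← Real.rpow_add hpos]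
        norm_num


end Torus

section RealHelpers

/-- `x⁸ ≤ A⁵ B³ ⟹ x ≤ A^{5/8} B^{3/8}` (nonnegative reals). [folklore] -/
theorem le_rpow_58_38_of_pow_le {x A B : ℝ} (hx : 0 ≤ x) (hA : 0 ≤ A) (hB : 0 ≤ B)
    (h : x ^ 8 ≤ A ^ 5 * B ^ 3) : x ≤ A ^ (5 / 8 : ℝ) * B ^ (3 / 8 : ℝ) := by
  have h1 : x = (x ^ 8) ^ ((8 : ℝ)⁻¹) := (Real.pow_rpow_inv_natCast hx (by norm_num : (8 : ℕ) ≠ 0)).symm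
  rw [h1]
  calc (x ^ 8) ^ ((8 : ℝ)⁻¹) ≤ (A ^ 5 * B ^ 3) ^ ((8 : ℝ)⁻¹) :=
        Real.rpow_le_rpow (by positivity) h (by norm_num)
    _ = A ^ (5 / 8 : ℝ) * B ^ (3 / 8 : ℝ) := by
        rw [Real.mul_rpow (by positivity) (by positivity), ← Real.rpow_natCast A 5,
          ← Real.rpow_natCast B 3, ← Real.rpow_mul hA, ← Real.rpow_mul hB]
        norm_num

/-- Weighted AM–GM with a free parameter `t ≥ 1`:
`A^{5/8} B^{3/8} ≤ (5/8)(t A) + (3/8)(B / t)`. [folklore] -/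
theorem rpow_58_38_le_young {A B t : ℝ} (hA : 0 ≤ A) (hB : 0 ≤ B) (ht : 1 ≤ t) :
    A ^ (5 / 8 : ℝ) * B ^ (3 / 8 : ℝ) ≤ (5 / 8) * (t * A) + (3 / 8) * (B / t) := by
  have ht0 : 0 < t := lt_of_lt_of_le one_pos ht
  have key := Real.geom_mean_le_arith_mean2_weighted (w₁ := 5 / 8) (w₂ := 3 / 8)
    (p₁ := t * A) (p₂ := t ^ (-(5 / 3) : ℝ) * B) (by norm_num) (by norm_num) (by positivity)
    (by positivity) (by norm_num)
  have hL : (t * A) ^ (5 / 8 : ℝ) * (t ^ (-(5 / 3) : ℝ) * B) ^ (3 / 8 : ℝ) =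
      A ^ (5 / 8 : ℝ) * B ^ (3 / 8 : ℝ) := by
    rw [Real.mul_rpow ht0.le hA, Real.mul_rpow (by positivity) hB, ← Real.rpow_mul ht0.le]
    have : t ^ (5 / 8 : ℝ) * t ^ (-(5 / 3) * (3 / 8) : ℝ) = 1 := by
      rw [← Real.rpow_add ht0]; norm_num
    calc t ^ (5 / 8 : ℝ) * A ^ (5 / 8 : ℝ) * (t ^ (-(5 / 3) * (3 / 8) : ℝ) * B ^ (3 / 8 : ℝ))
        = (t ^ (5 / 8 : ℝ) * t ^ (-(5 / 3) * (3 / 8) : ℝ)) * (A ^ (5 / 8 : ℝ) * B ^ (3 / 8 : ℝ)) := by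
          ring
      _ = A ^ (5 / 8 : ℝ) * B ^ (3 / 8 : ℝ) := by rw [this, one_mul]
  rw [hL] at key
  have hpow : t ^ (-(5 / 3) : ℝ) ≤ t⁻¹ := by
    have := Real.rpow_le_rpow_of_exponent_le ht (show (-(5 / 3) : ℝ) ≤ -1 by norm_num)
    rwa [Real.rpow_neg_one] at this
  have hR : t ^ (-(5 / 3) : ℝ) * B ≤ B / t := by
    calc t ^ (-(5 / 3) : ℝ) * B ≤ t⁻¹ * B := mul_le_mul_of_nonneg_right hpow hB
      _ = B / t := by ring
  linarith [key, hR]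


end RealHelpers

section OnsagerPincerProof

open Literature.Analysis.FunctionSpaces Literature.Analysis.FluidPDE

/-- ENNReal core of the floor-side pincer: `[v]^{16}_{B^{3/4}_{16/7,∞}} ≤ (3‖∇v‖²)⁵ · ([v]²_{B^{1/3}_{3,∞}})³`. -/
theorem eBesovSupSeminorm_floor_pow_sixteen_le {v : UnitAddTorus (Fin 3) → EuclideanSpace ℝ (Fin 3)}
    (hv : MemLp v 2 volume) :
    eBesovSupSeminorm (3 / 4 : ℝ) (16 / 7 : ℝ≥0∞) v volume ^ 16 ≤
      (3 * Torus.eGradNormSq v) ^ 5 * (eBesovSupSeminorm (1 / 3 : ℝ) (3 : ℝ≥0∞) v volume ^ 2) ^ 3 := by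
  set NF := eBesovSupSeminorm (3 / 4 : ℝ) (16 / 7 : ℝ≥0∞) v volume
  set N₁ := eBesovSupSeminorm 1 2 v volume
  set NO := eBesovSupSeminorm (1 / 3 : ℝ) (3 : ℝ≥0∞) v volume
  set G := Torus.eGradNormSq v
  have hB := eBesovSupSeminorm_floor_le_onsager hv.aestronglyMeasurable
  have h1 : N₁ ≤ ENNReal.ofReal (Real.sqrt 3) * G ^ (1 / 2 : ℝ) :=
    KolmogorovPincerIncrementPincerTG.eBesovSupSeminorm_one_two_le_sqrt_three hv
  have h2 : N₁ ^ 2 ≤ 3 * G := by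
    calc N₁ ^ 2 ≤ (ENNReal.ofReal (Real.sqrt 3) * G ^ (1 / 2 : ℝ)) ^ 2 := by gcongr
      _ = ENNReal.ofReal (Real.sqrt 3) ^ 2 * (G ^ (1 / 2 : ℝ)) ^ 2 := mul_pow _ _ _
      _ = 3 * G := by
          rw [← ENNReal.ofReal_pow (Real.sqrt_nonneg _), Real.sq_sqrt (by norm_num : (0:ℝ) ≤ 3),
            ← ENNReal.rpow_two (G ^ (1 / 2 : ℝ)), ← ENNReal.rpow_mul, ENNReal.ofReal_ofNat]
          norm_num
  have h3 : NF ^ 16 ≤ (N₁ ^ 2) ^ 5 * (NO ^ 2) ^ 3 := by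
    calc NF ^ 16 ≤ (N₁ ^ (5 / 8 : ℝ) * NO ^ (3 / 8 : ℝ)) ^ 16 := by gcongr
      _ = (N₁ ^ 2) ^ 5 * (NO ^ 2) ^ 3 := by
          rw [mul_pow, ← ENNReal.rpow_natCast (N₁ ^ (5 / 8 : ℝ)), ← ENNReal.rpow_natCast (NO ^ (3 / 8 : ℝ)),
            ← ENNReal.rpow_mul, ← ENNReal.rpow_mul, ← pow_mul, ← pow_mul,
            ← ENNReal.rpow_natCast N₁, ← ENNReal.rpow_natCast NO]
          norm_num
  calc NF ^ 16 ≤ (N₁ ^ 2) ^ 5 * (NO ^ 2) ^ 3 := h3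
    _ ≤ (3 * G) ^ 5 * (NO ^ 2) ^ 3 := by gcongr

/-- Real form in K41 weights: `X⁸ ≤ (3D)⁵ Z₀³` at a time slice (`X = ν^{5/8}[v]²_{B^{3/4}_{16/7,∞}}`,
`D = ν‖∇v‖₂²`, `Z₀ = [v]²_{B^{1/3}_{3,∞}}`). -/
theorem floor_pow_eight_le_real {ν : ℝ} (hν : 0 < ν) {v : UnitAddTorus (Fin 3) → EuclideanSpace ℝ (Fin 3)}
    (hv : MemLp v 2 volume) (hG : Torus.eGradNormSq v < ⊤)
    (hO : eBesovSupSeminorm (1 / 3 : ℝ) (3 : ENNReal) v volume < ⊤) :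
    (ν ^ (5 / 8 : ℝ) * ((eBesovSupSeminorm (3 / 4 : ℝ) (16 / 7 : ENNReal) v volume) ^ 2).toReal) ^ 8 ≤
      (3 * (ν * (Torus.eGradNormSq v).toReal)) ^ 5 *
        (((eBesovSupSeminorm (1 / 3 : ℝ) (3 : ENNReal) v volume) ^ 2).toReal) ^ 3 := by
  set NF := eBesovSupSeminorm (3 / 4 : ℝ) (16 / 7 : ENNReal) v volume
  set NO := eBesovSupSeminorm (1 / 3 : ℝ) (3 : ENNReal) v volume
  set G := Torus.eGradNormSq v
  have key := eBesovSupSeminorm_floor_pow_sixteen_le hv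
  have hfin : (3 * G) ^ 5 * (NO ^ 2) ^ 3 ≠ ⊤ :=
    ENNReal.mul_ne_top (ENNReal.pow_ne_top (ENNReal.mul_ne_top (by norm_num) hG.ne))
      (ENNReal.pow_ne_top (ENNReal.pow_ne_top hO.ne))
  have h1 : ((NF ^ 2).toReal) ^ 8 ≤ (3 * G.toReal) ^ 5 * ((NO ^ 2).toReal) ^ 3 := by
    have := ENNReal.toReal_mono hfin key
    rw [ENNReal.toReal_mul, ENNReal.toReal_pow, ENNReal.toReal_pow, ENNReal.toReal_mul,
      ENNReal.toReal_ofNat, ENNReal.toReal_pow] at this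
    calc ((NF ^ 2).toReal) ^ 8 = (NF.toReal ^ 2) ^ 8 := by rw [ENNReal.toReal_pow]
      _ = NF.toReal ^ 16 := by ring
      _ ≤ (3 * G.toReal) ^ 5 * ((NO ^ 2).toReal) ^ 3 := this
  have hν58 : (ν ^ (5 / 8 : ℝ)) ^ 8 = ν ^ 5 := by
    rw [← Real.rpow_natCast (ν ^ (5 / 8 : ℝ)) 8, ← Real.rpow_mul hν.le]
    norm_num
  calc (ν ^ (5 / 8 : ℝ) * (NF ^ 2).toReal) ^ 8 = (ν ^ (5 / 8 : ℝ)) ^ 8 * ((NF ^ 2).toReal) ^ 8 :=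
        mul_pow _ _ _
    _ ≤ ν ^ 5 * ((3 * G.toReal) ^ 5 * ((NO ^ 2).toReal) ^ 3) := by
        rw [hν58]; gcongr
    _ = _ := by ring

/-- Linearised floor-side pincer at a time slice: for every `t ≥ 1`,
`X ≤ (15/8)·t·D + (3/8)·Z₀/t`. -/
theorem floor_le_young_real {ν : ℝ} (hν : 0 < ν) {v : UnitAddTorus (Fin 3) → EuclideanSpace ℝ (Fin 3)}
    (hv : MemLp v 2 volume) (hG : Torus.eGradNormSq v < ⊤)
    (hO : eBesovSupSeminorm (1 / 3 : ℝ) (3 : ENNReal) v volume < ⊤) {t : ℝ} (ht : 1 ≤ t) :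
    ν ^ (5 / 8 : ℝ) * ((eBesovSupSeminorm (3 / 4 : ℝ) (16 / 7 : ENNReal) v volume) ^ 2).toReal ≤
      (15 / 8) * t * (ν * (Torus.eGradNormSq v).toReal) +
        (3 / 8) * (((eBesovSupSeminorm (1 / 3 : ℝ) (3 : ENNReal) v volume) ^ 2).toReal) / t := by
  have h8 := floor_pow_eight_le_real hν hv hG hO
  have hA : 0 ≤ 3 * (ν * (Torus.eGradNormSq v).toReal) := by positivity
  have hB : 0 ≤ ((eBesovSupSeminorm (1 / 3 : ℝ) (3 : ENNReal) v volume) ^ 2).toReal :=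
    ENNReal.toReal_nonneg
  have h1 := le_rpow_58_38_of_pow_le (by positivity) hA hB h8
  have h2 := rpow_58_38_le_young hA hB ht
  calc _ ≤ _ := h1.trans h2
    _ = _ := by ring

/-- **Route decl `KolmogorovPincer.OnsagerPincerTG` (stmt-AnomalousDissipation-32782), proved.**
Proof = the linearised floor-side pincer at a.e. time (`floor_le_young_real` with the Young parameter
`l := max 1 (3M/(4ε))`, `‖∇u(t)‖₂ < ∞` a.e. from the Leray–Hopf gradient integrability and guard (a)),
additivity / monotonicity of the running means (tree `timeMean_add`, `timeMean_const_mul`), the from-rest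
a-priori bound on the dissipation means (tree `Torus.IsLerayHopfOn.intervalIntegral_power_bounds`,
`E₀ = 0`), and `limsup = sInf` of eventual upper bounds; the force clauses come from the landed
`kolmogorovPincer_taylorGreenForceRegularTG` (item 24257). [folklore] -/
theorem kolmogorovPincer_onsagerPincerTG : KolmogorovPincer.OnsagerPincerTG := by
  intro f hf ν hν u hu ε M hε hM hXε ha hb hc
  obtain ⟨T₀, hc⟩ := hc
  obtain ⟨hfs, -, hfz⟩ := TaylorGreenForceRegular.kolmogorovPincer_taylorGreenForceRegularTG f hf
  have hf2 : MemLp f 2 volume := hfs.memLp 2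
  -- the Young parameter
  set l : ℝ := max 1 (3 * M / (4 * ε)) with hl
  have hl1 : 1 ≤ l := le_max_left _ _
  have hl0 : 0 < l := lt_of_lt_of_le one_pos hl1
  -- the three signals
  set X : ℝ → ℝ := fun t => ν ^ (5 / 8 : ℝ) *
    ((eBesovSupSeminorm (3 / 4 : ℝ) (16 / 7 : ENNReal) (u t) volume) ^ 2).toReal with hXdef
  set Z : ℝ → ℝ := fun t =>
    ((eBesovSupSeminorm (1 / 3 : ℝ) (3 : ENNReal) (u t) volume) ^ 2).toReal with hZdef
  set D : ℝ → ℝ := fun t => ν * (Torus.eGradNormSq (u t)).toReal with hDdef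
  have hX0 : ∀ t, 0 ≤ X t := fun t => by positivity
  have hZ0 : ∀ t, 0 ≤ Z t := fun t => ENNReal.toReal_nonneg
  have hD0 : ∀ t, 0 ≤ D t := fun t => by positivity
  -- (1) dissipation means: integrable and bounded for this ν (from rest, `E₀ = 0`)
  set A : ℝ := (4 * Real.pi ^ 2 * ν)⁻¹ / 2 * ∫ x, ‖f x‖ ^ 2 with hA
  have hKE : Torus.kineticEnergy (0 : UnitAddTorus (Fin 3) → EuclideanSpace ℝ (Fin 3)) = 0 := by
    simp [Torus.kineticEnergy]
  have hDT : ∀ T, 0 < T → IntervalIntegrable D volume 0 T ∧ timeMean D T ≤ 2 * A := by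
    intro T hT
    have hLH := hu T hT
    refine ⟨(hLH.intervalIntegral_dissipation_eq hT).1, ?_⟩
    have hbd := (hLH.intervalIntegral_power_bounds hT hν hf2 hfz).1
    rw [hKE] at hbd
    unfold timeMean
    rw [inv_mul_le_iff₀ hT]
    calc ∫ t in (0 : ℝ)..T, D t ≤ 2 * 0 + 2 * A * T := hbd
      _ = T * (2 * A) := by ring
  -- (2) the LINEAR running-mean inequality `⟨X⟩_T ≤ (15/8) l ⟨D⟩_T + (3/(8 l)) M` for `T ≥ T₀`, `T > 0`
  have hlin : ∀ T, 0 < T → T₀ ≤ T →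
      timeMean X T ≤ (15 / 8) * l * timeMean D T + (3 / 8) * M / l := by
    intro T hT hTT
    have hDm := hDT T hT
    have hDnn : 0 ≤ timeMean D T := timeMean_nonneg hD0 hT.le
    have hZle : timeMean Z T ≤ M := hc T hTT
    -- the comparison function
    set g : ℝ → ℝ := fun t => (15 / 8) * l * D t + (3 / 8) / l * Z t with hgdef
    have hDi : IntegrableOn D (Set.Ioc 0 T) :=
      (intervalIntegrable_iff_integrableOn_Ioc_of_le hT.le).1 hDm.1
    have hgi : IntegrableOn g (Set.Ioc 0 T) :=
      (hDi.const_mul ((15 / 8) * l)).add ((hb T hT).const_mul ((3 / 8) / l))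
    have hgmean : timeMean g T = (15 / 8) * l * timeMean D T + (3 / 8) / l * timeMean Z T := by
      have h1 := timeMean_add (f := fun t => (15 / 8) * l * D t) (g := fun t => (3 / 8) / l * Z t) hT.le
        (hDi.const_mul _) ((hb T hT).const_mul _)
      rw [timeMean_const_mul ((15 / 8) * l) D T, timeMean_const_mul ((3 / 8) / l) Z T] at h1
      exact h1
    have hXg : timeMean X T ≤ timeMean g T := by
      by_cases hXi : IntegrableOn X (Set.Ioc 0 T)
      · have hLH := hu T hT
        have hGfin : ∀ᵐ t ∂(volume.restrict (Set.Ioc 0 T)), Torus.eGradNormSq (u t) < ⊤ := by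
          have h1 : ∀ᵐ t ∂(volume.restrict (Set.Ioo 0 T)), Torus.eGradNormSq (u t) < ⊤ :=
            ae_lt_top' hLH.aemeasurable_eGradNormSq hLH.lintegral_eGradNormSq_lt_top.ne
          rw [← Measure.restrict_congr_set (Ioo_ae_eq_Ioc (μ := (volume : Measure ℝ)) (a := 0) (b := T))]
          exact h1
        have haT : ∀ᵐ t ∂(volume.restrict (Set.Ioc 0 T)),
            eBesovSupSeminorm (1 / 3 : ℝ) (3 : ENNReal) (u t) volume < ⊤ :=
          ae_restrict_of_ae_restrict_of_subset Set.Ioc_subset_Ioi_self ha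
        have hmem : ∀ᵐ t ∂(volume.restrict (Set.Ioc 0 T)), t ∈ Set.Ioc 0 T :=
          ae_restrict_mem measurableSet_Ioc
        have hae : ∀ᵐ t ∂(volume.restrict (Set.Ioc 0 T)), X t ≤ g t := by
          filter_upwards [hGfin, haT, hmem] with t hGt hOt htmem
          have := floor_le_young_real hν (hu.memLp_two htmem.1.le) hGt hOt hl1
          calc X t ≤ (15 / 8) * l * (ν * (Torus.eGradNormSq (u t)).toReal) +
                (3 / 8) * (((eBesovSupSeminorm (1 / 3 : ℝ) (3 : ENNReal) (u t) volume) ^ 2).toReal) / l :=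
                this
            _ = g t := by simp only [hgdef, hDdef, hZdef]; ring
        unfold timeMean
        rw [intervalIntegral.integral_of_le hT.le, intervalIntegral.integral_of_le hT.le]
        exact mul_le_mul_of_nonneg_left (integral_mono_ae hXi hgi hae) (inv_nonneg.2 hT.le)
      · have h0 : timeMean X T = 0 := by
          unfold timeMean
          rw [intervalIntegral.integral_of_le hT.le, integral_undef hXi, mul_zero]
        rw [h0]
        have hg0 : ∀ t, 0 ≤ g t := fun t => by positivity
        exact timeMean_nonneg hg0 hT.le
    calc timeMean X T ≤ timeMean g T := hXg
      _ = (15 / 8) * l * timeMean D T + (3 / 8) / l * timeMean Z T := hgmean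
      _ ≤ (15 / 8) * l * timeMean D T + (3 / 8) / l * M := by gcongr
      _ = _ := by ring
  -- (3) every eventual upper bound `b` of the dissipation means dominates `4ε/(15 l)`
  have hMl : (3 / 8) * M / l ≤ ε / 2 := by
    have h34 : 3 * M / (4 * ε) ≤ l := le_max_right _ _
    rw [div_le_iff₀ hl0]
    have : 3 * M ≤ l * (4 * ε) := by rwa [div_le_iff₀ (by positivity)] at h34
    linarith
  have hbound : ∀ b : ℝ, (∀ᶠ T in atTop, timeMean D T ≤ b) → 4 * ε / (15 * l) ≤ b := by
    intro b hbev
    have hev : ∀ᶠ T in atTop, timeMean X T ≤ (15 / 8) * l * b + ε / 2 := by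
      filter_upwards [hbev, eventually_gt_atTop 0, eventually_ge_atTop T₀] with T hTb hT hTT
      calc timeMean X T ≤ (15 / 8) * l * timeMean D T + (3 / 8) * M / l := hlin T hT hTT
        _ ≤ (15 / 8) * l * b + ε / 2 := by gcongr
    have hco : IsCoboundedUnder (· ≤ ·) atTop (timeMean X) :=
      isCoboundedUnder_le_of_eventually_le atTop
        ((eventually_ge_atTop 0).mono fun T hT => timeMean_nonneg hX0 hT)
    have hlim : longTimeAvgSup X ≤ (15 / 8) * l * b + ε / 2 := limsup_le_of_le hco hev
    have hεle : ε ≤ (15 / 8) * l * b + ε / 2 := hXε.trans hlim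
    rw [div_le_iff₀ (by positivity)]
    nlinarith [hεle, hl0]
  -- (4) `meanDissipation = limsup = sInf {eventual upper bounds}`
  show 4 * ε / (15 * max 1 (3 * M / (4 * ε))) ≤ meanDissipation ν u
  rw [← hl]
  unfold meanDissipation longTimeAvgSup
  rw [Filter.limsup_eq]
  exact le_csInf ⟨2 * A, (eventually_gt_atTop 0).mono fun T hT => (hDT T hT).2⟩ fun b hb => hbound b hb


end OnsagerPincerProof

end Summit.AnomalousDissipation.AnomalousDissipation.Theorems.KolmogorovPincerOnsagerPincerTG
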